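import Literature.MathematicalPhysics.QuantumLattice.HubbardTTPrimeOpenBoxGrandCanonicalPressureExact
import Literature.MathematicalPhysics.QuantumLattice.InfVolFermionStateTTPrimeMeanEnergyBox
import Literature.MathematicalPhysics.QuantumLattice.TIStateMeanEntropy
import Literature.MathematicalPhysics.QuantumLattice.HubbardTTPrimeThermalPressureZeeman
import HarnessLib

/-!
# The T > 0 CLUSTER CAP: `ℓ² · P(β; t,t',U; μ,h) ≤ log Re Ξ^open_ℓ(β; κt, κ²t', U; μ,h)`, `κ = ℓ/(ℓ−1)`
# — a two-sided certified window on the thermodynamic pressure from ONE open cluster at two hopping values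

Topic `Literature/MathematicalPhysics/QuantumLattice` (family `hubbard`; crew hubbard-fast S2 «T > 0 / families of models»).
The exact open-box FLOOR `log Re Ξ^open_ℓ(β; t,t',U; μ,h) ≤ ℓ²·P` (`HubbardTTPrimeOpenBoxGrandCanonicalPressureExact`, the
Gibbs–Bogoliubov / product-state half of the variational principle) is complemented here by the ENTROPY-SUBADDITIVITY CAP:
for every translation-invariant state `ω` of the lattice fermions on `ℤ²`,

* `s̄(ω) ≤ S(ω_{[0,ℓ)²})/ℓ²` (`TIStateMeanEntropy`: subadditivity of the entropy of even states over box tilings), and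
* **`Re ω(K^{κt, κ²t'}_{[0,ℓ)²}(U,μ,h)) = ℓ² · u_{t,t'}(ω)` EXACTLY** for the BOOSTED hoppings `κt`, `κ²t'`, `κ = ℓ/(ℓ−1)`
  (`IsTranslationInvariant.re_expect_gcLocalHamiltonianTT'_boost_halfOpenBox`): the open box `[0,ℓ)²` contains `ℓ²` sites but only
  `ℓ(ℓ−1)` nearest-neighbour bonds per direction and `(ℓ−1)²` diagonal bonds per direction (`card_filter_add_unitVec_mem_halfOpenBox`,
  `card_filter_add_diagVec_mem_halfOpenBox`), and in a translation-invariant state all bonds of one direction carry the same energy;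

so Gibbs' finite-volume inequality `S(ρ) − β Re tr(ρK) ≤ log Tr e^{−βK}` for the box marginal `ρ = ω_{[0,ℓ)²}` and the boosted local
grand-canonical Hamiltonian gives `S(ω_B)/ℓ² − β u(ω) ≤ ℓ⁻² log Re Tr e^{−βK^{κt,κ²t'}_B}` uniformly in `ω`, i.e.

* **`varPressure_gcInteractionTT'_le_log_partitionFn_boost`**: `P(β, Φ(t,t',U) − μn − hm) ≤ ℓ⁻² log Re Tr e^{−βK^{κt,κ²t'}_{[0,ℓ)²}}` for
  EVERY real `β`, every `t, t', U, μ, h`, every `ℓ ≥ 2` (the variational pressure; no sign conditions);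
* **`varPressure_gcInteractionTT'_le_log_partitionFn_boost_sub`** — the same with ANY Hermitian `G` on the box killed by every
  translation-invariant state (`Re ω(G) = 0`: differences of translates of one local observable inside the box, …) added to the
  exponent: `P ≤ ℓ⁻² log Re Tr e^{−(βK^{κt,κ²t'}_B − G)}` (translation MULTIPLIERS tighten the cap at no cost in rigour);
* **`sq_mul_gcPressureTT'Zeeman_le_log_partitionFn_openBox_boost`** (`β ≥ 0`, `U ≥ 0`, by name):
  `ℓ² · gcPressureTT'Zeeman β t t' U μ h ≤ log Re Ξ^open_ℓ(β; κt, κ²t', U; μ, h)` with `Ξ^open` the partition function of the tree's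
  open-box matrix `hubbardOpenBoxTT' ℓ ℓ (κt) (κ²t') U − μN − hM`;
* **`sq_mul_gcPressureTT'Zeeman_mem_Icc_openBox`** — THE TWO-SIDED CLUSTER WINDOW
  `log Re Ξ^open_ℓ(t,t') ≤ ℓ²·P ≤ log Re Ξ^open_ℓ(κt, κ²t')`, and its certificate form `gcPressureTT'Zeeman_mem_Icc_of_openBox_certificates`
  (certified `z_lo ≤ log Re Ξ^open_ℓ(t,t')`, `log Re Ξ^open_ℓ(κt,κ²t') ≤ z_hi` ⇒ `P ∈ [z_lo/ℓ², z_hi/ℓ²]`);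
* the PLAQUETTE CAP `4·P ≤ log Re Ξ^open_2(β; 2t, 4t', U; μ, h)` (`ℓ = 2`, `κ = 2`) and the canonical readings
  `pressureTT'Zeeman β t t' U n h ≤ z_hi/ℓ² − βμn`, `pressureTT' β t t' U n ≤ z_hi/ℓ² − βμn` for every `μ` (ensemble equivalence).

The cap is the `T > 0` twin of Anderson's cluster lower bound with Valentí–Stolze–Hirschfeld weights (its `β → ∞` limit is the
uniformly weighted open-cluster bound `e₀ ≥ ℓ⁻² E₀(h^open_ℓ(κt, κ²t', U))`); the entropy side is Araki–Moriya's subadditivity. Width of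
the window per site `≤ β(κ−1)(|e_t| + (κ+1)|e_{t'}|)`-type, i.e. `O(β|t|/ℓ)`, with NO `β·perimeter·‖Φ‖` collar (compare
`VariationalPressureBoxPartitionFunctionBound`). Everything is PROVED; no definition, no named fact, no number.

HOW TO USE (thermal crew / box-eng T-cells / kernel ED devices): evaluate (or certify from below resp. above) the grand-canonical
partition function of the open `ℓ × ℓ` `t–t'` Hubbard cluster ONCE at `(t, t')` and ONCE at `(κt, κ²t')`, same `(β, U, μ, h)`:
`ℓ = 2`: `(2t, 4t')`, dimension `4⁴`; `ℓ = 3`: `(3t/2, 9t'/4)`, dimension `4⁹` in `(N↑,N↓)` blocks `≤ 15876`. Then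
`gcPressureTT'Zeeman_mem_Icc_of_openBox_certificates` is the window; three `β`'s give thermal energy windows by the chord device
(`HubbardTTPrimeThermalPressure`), `μ ± δ` give density brackets (`…DensityBrackets`).

## Mathlib / tree search

REUSED: `log_partitionFn_openBox_gc_le_sq_mul_gcPressure`, `partitionFn_gcLocalHamiltonianTT'_halfOpenBox`,
`gcLocalHamiltonianTT'_isHermitian`, `gcLocalHamiltonianTT'_eq` (open-box pressure files); `varPressure_le_of_boxEntropy`,
`boxEntropyDensity_apply` (`TIStateMeanEntropy`, `TIVariationalPressure`); `varPressure_gcInteractionTT'_eq`, `meanEnergy_gcInteractionTT'`;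
`IsHermitian.vonNeumannEntropy_sub_mul_le_log_partitionFn` (`GibbsVariationalPrinciple`); `trace_rdm_mul`, `rdm_posSemidef`, `trace_rdm`;
`IsTranslationInvariant.expect_hubbard_localHamiltonian / _meanEnergyObs`, `…expect_diagHopping_localHamiltonian`,
`…meanEnergy_hubbardTTPrime_eq`, `…re_expect_totalNumber`, `…re_expect_spinImbalance`; `hubbardFermionInteraction_apply_singleton/_pair`,
`diagHoppingFermionInteraction_apply_pair`; `pressureTT'Zeeman_add_le_gcPressureTT'Zeeman`, `pressureTT'_le_gcPressureTT'_sub`,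
`gcPressureTT'Zeeman_zero`. `lean search 'boost|weighted.*varPressure|varPressure.*weighted|card_filter_add_unitVec_mem'` (2026-08-28):
only the `≤ ℓ` boundary counts and the collar form `varPressure_le_log_partitionFn_box`; the T = 0 weighted-cluster bounds
(`HubbardAndersonClusterBound`, `HubbardNNNHoppingClusterLowerBound`) have no thermal twin in the tree.

## References

* R. B. Israel, *Convexity in the Theory of Lattice Gases* (1979), Lemma II.3.1 (finite-volume variational principle) and Thm. I.2.4.
  [cite: Israel1979, Lemma II.3.1]
* H. Araki, H. Moriya, Rev. Math. Phys. 15 (2003) 93, Thm. 3.8 and §10 (subadditivity, mean entropy of even states).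
  [cite: ArakiMoriya2003, Theorem 3.8 and §10]
* P. W. Anderson, Phys. Rev. 83 (1951) 1260, eq. (2); R. Valentí, J. Stolze, P. J. Hirschfeld, Phys. Rev. B 43 (1991) 13743, §II
  (weighted open clusters). [cite: Anderson1951, eq. (2)] [cite: ValentiStolzeHirschfeld1991, §II]
* D. Ruelle, *Statistical Mechanics* (1969), §3.4 (ensembles). [cite: Ruelle1969, §3.4]
-/

noncomputable section

open scoped ComplexOrder BigOperators
open Finset Literature.InformationTheory.Entropy

namespace Literature.MathematicalPhysics.QuantumLattice

open Matrix HubbardWave0 Literature.Probability.LatticeModels ThermodynamicLimit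
open scoped Matrix.Norms.L2Operator

/-! ### §1 Interior bond counts of the open box `[0,ℓ)^d` -/

/-- **The sites of `[0,ℓ)^d` whose `v`-neighbour stays in the box form a product of integer intervals**:
`{x ∈ [0,ℓ)^d : x + v ∈ [0,ℓ)^d} = Π_i [max(0,−vᵢ), min(ℓ, ℓ−vᵢ))` (the placements of a bond shape inside an open
cluster). [cite: ValentiStolzeHirschfeld1991, §II] -/
theorem filter_add_mem_halfOpenBox_eq_piFinset {d : ℕ} (ℓ : ℕ) (v : Site d) :
    ((halfOpenBox d ℓ).filter fun x => x + v ∈ halfOpenBox d ℓ) =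
      Fintype.piFinset fun i => Finset.Ico (max 0 (-v i)) (min (ℓ : ℤ) (ℓ - v i)) := by
  ext x
  simp only [Finset.mem_filter, mem_halfOpenBox, Fintype.mem_piFinset, Finset.mem_Ico, Pi.add_apply, max_le_iff,
    lt_min_iff]
  constructor
  · rintro ⟨h1, h2⟩ i
    obtain ⟨a, b⟩ := h1 i
    obtain ⟨c, e⟩ := h2 i
    refine ⟨⟨a, ?_⟩, b, ?_⟩ <;> omega
  · intro h
    refine ⟨fun i => ?_, fun i => ?_⟩
    · obtain ⟨⟨a, b⟩, c, e⟩ := h i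
      exact ⟨a, c⟩
    · obtain ⟨⟨a, b⟩, c, e⟩ := h i
      constructor <;> omega

/-- **Counting form**: `#{x ∈ [0,ℓ)^d : x + v ∈ [0,ℓ)^d} = Π_i (min(ℓ, ℓ−vᵢ) − max(0,−vᵢ))⁺` (number of bonds of direction `v` of an
open cluster). [cite: ValentiStolzeHirschfeld1991, §II] -/
theorem card_filter_add_mem_halfOpenBox {d : ℕ} (ℓ : ℕ) (v : Site d) :
    ((halfOpenBox d ℓ).filter fun x => x + v ∈ halfOpenBox d ℓ).card =
      ∏ i, ((min (ℓ : ℤ) (ℓ - v i)) - max 0 (-v i)).toNat := by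
  rw [filter_add_mem_halfOpenBox_eq_piFinset, Fintype.card_piFinset]
  simp_rw [Int.card_Ico]

/-- The interval factor of a coordinate moving by `+1`: `(min(ℓ, ℓ−1) − max(0,−1))⁺ = ℓ − 1`. [folklore] -/
private theorem toNat_factor_one (ℓ : ℕ) : ((min (ℓ : ℤ) (ℓ - 1)) - max 0 (-1)).toNat = ℓ - 1 := by omega

/-- The interval factor of a fixed coordinate: `(min(ℓ, ℓ) − max(0,0))⁺ = ℓ`. [folklore] -/
private theorem toNat_factor_zero (ℓ : ℕ) : ((min (ℓ : ℤ) (ℓ - 0)) - max 0 (-0)).toNat = ℓ := by omega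

/-- The interval factor of a coordinate moving by `−1`: `(min(ℓ, ℓ+1) − max(0,1))⁺ = ℓ − 1`. [folklore] -/
private theorem toNat_factor_neg_one (ℓ : ℕ) : ((min (ℓ : ℤ) (ℓ - (-1))) - max 0 (-(-1))).toNat = ℓ - 1 := by omega

/-- **The open box `[0,ℓ)^d` has `(ℓ−1)ℓ^{d−1}` nearest-neighbour bonds in each direction**:
`#{x ∈ [0,ℓ)^d : x + e_i ∈ [0,ℓ)^d} = (ℓ−1)·ℓ^{d−1}`. [cite: ValentiStolzeHirschfeld1991, §II] -/
theorem card_filter_add_unitVec_mem_halfOpenBox {d : ℕ} (ℓ : ℕ) (i : Fin d) :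
    ((halfOpenBox d ℓ).filter fun x => x + unitVec i ∈ halfOpenBox d ℓ).card = (ℓ - 1) * ℓ ^ (d - 1) := by
  rw [card_filter_add_mem_halfOpenBox, ← Finset.mul_prod_erase _ _ (Finset.mem_univ i)]
  congr 1
  · have h : (unitVec i : Site d) i = 1 := by simp [unitVec]
    rw [h, toNat_factor_one]
  · rw [Finset.prod_congr rfl fun j hj => ?_, Finset.prod_const, Finset.card_erase_of_mem (Finset.mem_univ i),
      Finset.card_univ, Fintype.card_fin]
    have hji : j ≠ i := (Finset.mem_erase.1 hj).1
    have h : (unitVec i : Site d) j = 0 := by simp [unitVec, hji]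
    rw [h, toNat_factor_zero]

/-- **Two dimensions**: `#{x ∈ [0,ℓ)² : x + e_i ∈ [0,ℓ)²} = ℓ(ℓ−1)`. [cite: ValentiStolzeHirschfeld1991, §II] -/
theorem card_filter_add_unitVec_mem_halfOpenBox_two (ℓ : ℕ) (i : Fin 2) :
    ((halfOpenBox 2 ℓ).filter fun x => x + unitVec i ∈ halfOpenBox 2 ℓ).card = ℓ * (ℓ - 1) := by
  rw [card_filter_add_unitVec_mem_halfOpenBox, mul_comm]
  norm_num

/-- **The open box `[0,ℓ)²` has `(ℓ−1)²` diagonal bonds in each diagonal direction**: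
`#{x ∈ [0,ℓ)² : x + j_s ∈ [0,ℓ)²} = (ℓ−1)²`, `j_s = e₁ ± e₂`. [cite: ValentiStolzeHirschfeld1991, §II] -/
theorem card_filter_add_diagVec_mem_halfOpenBox (ℓ : ℕ) (s : Fin 2) :
    ((halfOpenBox 2 ℓ).filter fun x => x + diagVec s ∈ halfOpenBox 2 ℓ).card = (ℓ - 1) ^ 2 := by
  rw [card_filter_add_mem_halfOpenBox, Fin.prod_univ_two]
  have h0 : (diagVec s : Site 2) 0 = 1 := by simp [diagVec]
  rw [h0, toNat_factor_one]
  by_cases hs : s = 0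
  · have h1 : (diagVec s : Site 2) 1 = 1 := by simp [diagVec, hs]
    rw [h1, toNat_factor_one, sq]
  · have h1 : (diagVec s : Site 2) 1 = -1 := by simp [diagVec, hs]
    rw [h1, toNat_factor_neg_one, sq]

/-! ### §2 Scaling of the interaction terms in the hopping amplitudes -/

/-- The on-site term does not depend on the hopping amplitude: `Φ^{t₁,U}{x} = Φ^{t₂,U}{x}`. [cite: arXiv9311033, §2 (the Hubbard Hamiltonian)] -/
theorem hubbardFermionInteraction_apply_singleton_hopping {d : ℕ} (t₁ t₂ U : ℝ) (x : Site d) :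
    (hubbardFermionInteraction d t₁ U).Φ {x} = (hubbardFermionInteraction d t₂ U).Φ {x} := by
  rw [hubbardFermionInteraction_apply_singleton, hubbardFermionInteraction_apply_singleton]

/-- **The bond term is linear in `t`**: `Φ^{ct,U}{x, x+e_i} = c · Φ^{t,U}{x, x+e_i}`. [cite: arXiv9311033, §2 (the Hubbard Hamiltonian)] -/
theorem hubbardFermionInteraction_apply_pair_mul {d : ℕ} (c t U : ℝ) (x : Site d) (i : Fin d) :
    (hubbardFermionInteraction d (c * t) U).Φ {x, x + unitVec i} =
      (c : ℂ) • (hubbardFermionInteraction d t U).Φ {x, x + unitVec i} := by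
  rw [hubbardFermionInteraction_apply_pair, hubbardFermionInteraction_apply_pair, smul_smul]
  congr 1
  push_cast
  ring

/-- **The diagonal bond term is linear in `t'`**: `Φ^{ct'}{x, x+j_s} = c · Φ^{t'}{x, x+j_s}`. [cite: XuEtAl2024, eq. (1)] -/
theorem diagHoppingFermionInteraction_apply_pair_mul (c t' : ℝ) (x : Site 2) (s : Fin 2) :
    (diagHoppingFermionInteraction (c * t')).Φ {x, x + diagVec s} =
      (c : ℂ) • (diagHoppingFermionInteraction t').Φ {x, x + diagVec s} := by
  rw [diagHoppingFermionInteraction_apply_pair, diagHoppingFermionInteraction_apply_pair, smul_smul]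
  congr 1
  push_cast
  ring

/-! ### §3 The EXACT box energy identity at boosted hoppings -/

namespace InfVolFermionState

variable {ω : InfVolFermionState 2}

/-- `ℓ/(ℓ−1) · (ℓ−1) = ℓ` for `ℓ ≥ 2`. [folklore] -/
private theorem boost_mul_sub_one {ℓ : ℕ} (hℓ : 2 ≤ ℓ) : (ℓ : ℝ) / ((ℓ : ℝ) - 1) * ((ℓ : ℝ) - 1) = ℓ := by
  have h2 : (2 : ℝ) ≤ ℓ := by exact_mod_cast hℓ
  have hℓ1 : (ℓ : ℝ) - 1 ≠ 0 := by linarith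
  field_simp

/-- **THE EXACT BOX ENERGY IDENTITY AT BOOSTED HOPPINGS** (`t–t'` Hubbard interaction, `ℓ ≥ 2`): for every translation-invariant
`ω`, `Re ω(H^{κt, κ²t', U}_{[0,ℓ)²}) = ℓ² · e^{t,t',U}(ω)` with `κ = ℓ/(ℓ−1)` — the `ℓ(ℓ−1)` nearest-neighbour bonds per direction of
the open box, boosted by `κ`, and its `(ℓ−1)²` diagonal bonds per direction, boosted by `κ²`, reproduce EXACTLY the `ℓ²` bonds per
direction per `ℓ²` sites of the infinite lattice (all bonds of one direction carry the same energy in a translation-invariant state).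
[cite: ValentiStolzeHirschfeld1991, §II] [cite: BratteliRobinsonII1997, §6.2.4 (Prop. 6.2.38 ff.)] -/
theorem IsTranslationInvariant.re_expect_localHamiltonian_hubbardTTPrime_boost_halfOpenBox (hω : ω.IsTranslationInvariant)
    (t t' U : ℝ) {ℓ : ℕ} (hℓ : 2 ≤ ℓ) :
    (ω.expect (halfOpenBox 2 ℓ) ((hubbardTTPrimeFermionInteraction ((ℓ : ℝ) / ((ℓ : ℝ) - 1) * t)
        (((ℓ : ℝ) / ((ℓ : ℝ) - 1)) ^ 2 * t') U).localHamiltonian (halfOpenBox 2 ℓ))).re =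
      (ℓ : ℝ) ^ 2 * ω.meanEnergy (hubbardTTPrimeFermionInteraction t t' U) 1 := by
  classical
  set κ : ℝ := (ℓ : ℝ) / ((ℓ : ℝ) - 1) with hκ
  set B := halfOpenBox 2 ℓ with hB
  set u : ℂ := ω.expect {0} ((hubbardFermionInteraction 2 t U).Φ {0}) with hu
  set h : Fin 2 → ℂ := fun i =>
    ω.expect {0, 0 + unitVec i} ((hubbardFermionInteraction 2 t U).Φ {0, 0 + unitVec i}) with hh
  set h' : Fin 2 → ℂ := fun s =>
    ω.expect {0, 0 + diagVec s} ((diagHoppingFermionInteraction t').Φ {0, 0 + diagVec s}) with hh'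
  have hκ1 : κ * ((ℓ : ℝ) - 1) = ℓ := boost_mul_sub_one hℓ
  have hℓ1 : 1 ≤ ℓ := by omega
  have hcardB : (B.card : ℂ) = (((ℓ : ℝ) ^ 2 : ℝ) : ℂ) := by
    rw [hB, card_halfOpenBox]; push_cast; ring
  have hcNN : ∀ i : Fin 2, (((B.filter fun x => x + unitVec i ∈ B).card : ℕ) : ℂ) = ((((ℓ : ℝ) * ((ℓ : ℝ) - 1)) : ℝ) : ℂ) := by
    intro i
    rw [hB, card_filter_add_unitVec_mem_halfOpenBox_two, Nat.cast_mul, Nat.cast_sub hℓ1]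
    push_cast; ring
  have hcD : ∀ s : Fin 2, (((B.filter fun x => x + diagVec s ∈ B).card : ℕ) : ℂ) = ((((ℓ : ℝ) - 1) ^ 2 : ℝ) : ℂ) := by
    intro s
    rw [hB, card_filter_add_diagVec_mem_halfOpenBox, Nat.cast_pow, Nat.cast_sub hℓ1]
    push_cast; ring
  -- nearest-neighbour part
  have hNN : (ω.expect B ((hubbardFermionInteraction 2 (κ * t) U).localHamiltonian B)).re =
      (ℓ : ℝ) ^ 2 * u.re + ∑ i, ((ℓ : ℝ) * ((ℓ : ℝ) - 1)) * (κ * (h i).re) := by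
    rw [hω.expect_hubbard_localHamiltonian (κ * t) U B, Complex.add_re, Complex.re_sum, hcardB,
      hubbardFermionInteraction_apply_singleton_hopping (κ * t) t U, Complex.re_ofReal_mul]
    congr 1
    refine Finset.sum_congr rfl fun i _ => ?_
    rw [hcNN i, hubbardFermionInteraction_apply_pair_mul κ t U 0 i, map_smul, smul_eq_mul, Complex.re_ofReal_mul,
      Complex.re_ofReal_mul]
  -- diagonal part
  have hD : (ω.expect B ((diagHoppingFermionInteraction (κ ^ 2 * t')).localHamiltonian B)).re =
      ∑ s, (((ℓ : ℝ) - 1) ^ 2) * (κ ^ 2 * (h' s).re) := by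
    rw [hω.expect_diagHopping_localHamiltonian (κ ^ 2 * t') B, Complex.re_sum]
    refine Finset.sum_congr rfl fun s _ => ?_
    rw [hcD s, diagHoppingFermionInteraction_apply_pair_mul (κ ^ 2) t' 0 s, map_smul, smul_eq_mul, Complex.re_ofReal_mul,
      Complex.re_ofReal_mul]
  -- the mean energy through the term expectations
  have he : ω.meanEnergy (hubbardTTPrimeFermionInteraction t t' U) 1 = u.re + ∑ i, (h i).re + ∑ s, (h' s).re := by
    rw [hω.meanEnergy_hubbardTTPrime_eq t' t U, InfVolFermionState.hubbardEnergyDensity, InfVolFermionState.meanEnergy,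
      hω.expect_hubbard_meanEnergyObs t U, Complex.add_re, Complex.re_sum]
  rw [hubbardTTPrimeFermionInteraction_localHamiltonian, map_add, Complex.add_re, hNN, hD, he]
  have e1 : ∀ x : ℝ, (ℓ : ℝ) * ((ℓ : ℝ) - 1) * (κ * x) = (ℓ : ℝ) ^ 2 * x := by
    intro x
    calc (ℓ : ℝ) * ((ℓ : ℝ) - 1) * (κ * x) = (ℓ : ℝ) * (κ * ((ℓ : ℝ) - 1)) * x := by ring
      _ = (ℓ : ℝ) ^ 2 * x := by rw [hκ1]; ring
  have e2 : ∀ x : ℝ, ((ℓ : ℝ) - 1) ^ 2 * (κ ^ 2 * x) = (ℓ : ℝ) ^ 2 * x := by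
    intro x
    calc ((ℓ : ℝ) - 1) ^ 2 * (κ ^ 2 * x) = (κ * ((ℓ : ℝ) - 1)) ^ 2 * x := by ring
      _ = (ℓ : ℝ) ^ 2 * x := by rw [hκ1]
  simp_rw [e1, e2, ← Finset.mul_sum]
  ring

/-- **The grand-canonical form**: for every translation-invariant `ω` and `ℓ ≥ 2`,
`Re ω(K^{κt,κ²t'}_{[0,ℓ)²}(U,μ,h)) = ℓ² · u(ω)`, `u(ω) = e^{t,t',U}(ω) − μρ(ω) − h m(ω)` the mean energy of the grand-canonical
interaction `Φ(t,t',U) − μn − hm` (`κ = ℓ/(ℓ−1)`; the on-site charges are exact on every box).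
[cite: ValentiStolzeHirschfeld1991, §II] [cite: BratteliRobinsonII1997, §6.2.4 (Prop. 6.2.38 ff.)] -/
theorem IsTranslationInvariant.re_expect_gcLocalHamiltonianTT'_boost_halfOpenBox (hω : ω.IsTranslationInvariant)
    (t t' U μ hz : ℝ) {ℓ : ℕ} (hℓ : 2 ≤ ℓ) :
    (ω.expect (halfOpenBox 2 ℓ) (gcLocalHamiltonianTT' (halfOpenBox 2 ℓ) ((ℓ : ℝ) / ((ℓ : ℝ) - 1) * t)
        (((ℓ : ℝ) / ((ℓ : ℝ) - 1)) ^ 2 * t') U μ hz)).re =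
      (ℓ : ℝ) ^ 2 * ω.meanEnergy (gcInteractionTT' t t' U μ hz) 1 := by
  have hN := hω.re_expect_totalNumber (halfOpenBox 2 ℓ)
  have hM := hω.re_expect_spinImbalance (halfOpenBox 2 ℓ)
  have hcard : ((halfOpenBox 2 ℓ).card : ℝ) = (ℓ : ℝ) ^ 2 := by rw [card_halfOpenBox]; push_cast; ring
  rw [hcard] at hN hM
  rw [gcLocalHamiltonianTT'_eq, map_sub, map_sub, map_smul, map_smul, Complex.sub_re, Complex.sub_re, smul_eq_mul,
    smul_eq_mul, Complex.re_ofReal_mul, Complex.re_ofReal_mul, hN, hM,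
    hω.re_expect_localHamiltonian_hubbardTTPrime_boost_halfOpenBox t t' U hℓ, ω.meanEnergy_gcInteractionTT']
  ring

/-! ### §4 The cluster cap on the variational pressure (every real `β`) -/

/-- **Per-state form**: for every translation-invariant `ω`, every real `β` and `ℓ ≥ 2`,
`S(ω_{[0,ℓ)²})/ℓ² − β u(ω) ≤ ℓ⁻² log Re Tr e^{−βK^{κt,κ²t'}_{[0,ℓ)²}}` (Gibbs' inequality for the box marginal and the boosted
local Hamiltonian, whose energy is exact). [cite: Israel1979, Lemma II.3.1] -/
theorem IsTranslationInvariant.boxEntropyDensity_sub_mul_le_log_partitionFn_boost (hω : ω.IsTranslationInvariant)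
    (β t t' U μ hz : ℝ) {ℓ : ℕ} (hℓ : 2 ≤ ℓ) :
    ω.boxEntropyDensity ℓ - β * ω.meanEnergy (gcInteractionTT' t t' U μ hz) 1 ≤
      Real.log (partitionFn β (gcLocalHamiltonianTT' (halfOpenBox 2 ℓ) ((ℓ : ℝ) / ((ℓ : ℝ) - 1) * t)
        (((ℓ : ℝ) / ((ℓ : ℝ) - 1)) ^ 2 * t') U μ hz)).re / (ℓ : ℝ) ^ 2 := by
  set B := halfOpenBox 2 ℓ with hB
  have hG := (gcLocalHamiltonianTT'_isHermitian B ((ℓ : ℝ) / ((ℓ : ℝ) - 1) * t) (((ℓ : ℝ) / ((ℓ : ℝ) - 1)) ^ 2 * t') U μ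
    hz).vonNeumannEntropy_sub_mul_le_log_partitionFn β (ω.rdm_posSemidef B) (ω.trace_rdm B)
  rw [trace_rdm_mul, hB, hω.re_expect_gcLocalHamiltonianTT'_boost_halfOpenBox t t' U μ hz hℓ] at hG
  have hℓpos : (0 : ℝ) < ℓ := by exact_mod_cast (show 0 < ℓ by omega)
  have hℓ2 : (0 : ℝ) < (ℓ : ℝ) ^ 2 := by positivity
  rw [boxEntropyDensity_apply]
  have key : vonNeumannEntropy (ω.rdm (halfOpenBox 2 ℓ)) / (ℓ : ℝ) ^ 2 - β * ω.meanEnergy (gcInteractionTT' t t' U μ hz) 1 =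
      (vonNeumannEntropy (ω.rdm (halfOpenBox 2 ℓ)) - β * ((ℓ : ℝ) ^ 2 * ω.meanEnergy (gcInteractionTT' t t' U μ hz) 1)) /
        (ℓ : ℝ) ^ 2 := by
    field_simp
  rw [key]
  exact div_le_div_of_nonneg_right hG hℓ2.le

/-- **THE T > 0 CLUSTER CAP** (variational pressure, every real `β`, every `t, t', U, μ, h`, every `ℓ ≥ 2`):
`P(β, Φ(t,t',U) − μn − hm) ≤ ℓ⁻² · log Re Tr e^{−βK^{κt,κ²t'}_{[0,ℓ)²}(U,μ,h)}`, `κ = ℓ/(ℓ−1)` — ONE open cluster with boosted hoppings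
caps the thermodynamic-limit pressure, with no boundary correction. [cite: Israel1979, Lemma II.3.1] [cite: ArakiMoriya2003, Theorem 3.8 and §10]
[cite: ValentiStolzeHirschfeld1991, §II] -/
theorem varPressure_gcInteractionTT'_le_log_partitionFn_boost (β t t' U μ hz : ℝ) {ℓ : ℕ} (hℓ : 2 ≤ ℓ) :
    (gcInteractionTT' t t' U μ hz).varPressure β 1 ≤
      Real.log (partitionFn β (gcLocalHamiltonianTT' (halfOpenBox 2 ℓ) ((ℓ : ℝ) / ((ℓ : ℝ) - 1) * t)
        (((ℓ : ℝ) / ((ℓ : ℝ) - 1)) ^ 2 * t') U μ hz)).re / (ℓ : ℝ) ^ 2 :=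
  varPressure_le_of_boxEntropy (by norm_num) β _ 1 (by omega : 1 ≤ ℓ) fun _ hω =>
    hω.boxEntropyDensity_sub_mul_le_log_partitionFn_boost β t t' U μ hz hℓ

/-- A real multiple of a Hermitian matrix minus a Hermitian matrix is Hermitian. [folklore] -/
private theorem isHermitian_ofReal_smul_sub {m : Type*} {K G : Matrix m m ℂ} (hK : K.IsHermitian) (hG : G.IsHermitian)
    (c : ℝ) : ((c : ℂ) • K - G).IsHermitian := by
  have h1 : ((c : ℂ) • K).IsHermitian := by
    rw [Matrix.IsHermitian, Matrix.conjTranspose_smul, hK.eq, Complex.star_def, Complex.conj_ofReal]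
  exact h1.sub hG

/-- **THE CLUSTER CAP WITH TRANSLATION MULTIPLIERS**: for every Hermitian `G` on the box Fock space KILLED BY EVERY
TRANSLATION-INVARIANT STATE (`Re ω(G) = 0` for all translation-invariant `ω` — e.g. any real combination of differences
`A − τ_v A` of translates of local observables inside the box), every real `β` and `ℓ ≥ 2`:
`P(β, Φ(t,t',U) − μn − hm) ≤ ℓ⁻² · log Re Tr e^{−(βK^{κt,κ²t'}_{[0,ℓ)²} − G)}`. The multipliers are free parameters of the
certificate (the cap is convex in `G`); `G = 0` is the previous theorem. [cite: Israel1979, Lemma II.3.1]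
[cite: ArakiMoriya2003, Theorem 3.8 and §10] -/
theorem varPressure_gcInteractionTT'_le_log_partitionFn_boost_sub (β t t' U μ hz : ℝ) {ℓ : ℕ} (hℓ : 2 ≤ ℓ)
    {G : FermionOp (halfOpenBox 2 ℓ)} (hGh : G.IsHermitian)
    (hG0 : ∀ ω : InfVolFermionState 2, ω.IsTranslationInvariant → (ω.expect (halfOpenBox 2 ℓ) G).re = 0) :
    (gcInteractionTT' t t' U μ hz).varPressure β 1 ≤
      Real.log (partitionFn 1 ((β : ℂ) • gcLocalHamiltonianTT' (halfOpenBox 2 ℓ) ((ℓ : ℝ) / ((ℓ : ℝ) - 1) * t)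
        (((ℓ : ℝ) / ((ℓ : ℝ) - 1)) ^ 2 * t') U μ hz - G)).re / (ℓ : ℝ) ^ 2 := by
  refine varPressure_le_of_boxEntropy (by norm_num) β _ 1 (by omega : 1 ≤ ℓ) fun ω hω => ?_
  have hKh : (gcLocalHamiltonianTT' (halfOpenBox 2 ℓ) ((ℓ : ℝ) / ((ℓ : ℝ) - 1) * t) (((ℓ : ℝ) / ((ℓ : ℝ) - 1)) ^ 2 * t')
      U μ hz).IsHermitian := gcLocalHamiltonianTT'_isHermitian _ _ _ U μ hz
  have hG := (isHermitian_ofReal_smul_sub hKh hGh β).vonNeumannEntropy_sub_mul_le_log_partitionFn 1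
    (ω.rdm_posSemidef _) (ω.trace_rdm _)
  rw [Matrix.mul_sub, Matrix.mul_smul, Matrix.trace_sub, Matrix.trace_smul, smul_eq_mul, trace_rdm_mul, trace_rdm_mul,
    Complex.sub_re, Complex.re_ofReal_mul, hG0 ω hω, sub_zero,
    hω.re_expect_gcLocalHamiltonianTT'_boost_halfOpenBox t t' U μ hz hℓ, one_mul] at hG
  have hℓpos : (0 : ℝ) < ℓ := by exact_mod_cast (show 0 < ℓ by omega)
  have hℓ2 : (0 : ℝ) < (ℓ : ℝ) ^ 2 := by positivity
  rw [boxEntropyDensity_apply]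
  have key : vonNeumannEntropy (ω.rdm (halfOpenBox 2 ℓ)) / (ℓ : ℝ) ^ 2 - β * ω.meanEnergy (gcInteractionTT' t t' U μ hz) 1 =
      (vonNeumannEntropy (ω.rdm (halfOpenBox 2 ℓ)) - β * ((ℓ : ℝ) ^ 2 * ω.meanEnergy (gcInteractionTT' t t' U μ hz) 1)) /
        (ℓ : ℝ) ^ 2 := by
    field_simp
  rw [key]
  exact div_le_div_of_nonneg_right hG hℓ2.le

/-- **Translation differences are killed by translation-invariant states**: for a local observable `A ∈ 𝔄_X`, `X ⊆ Λ`, and a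
lattice vector `v` with `X + v ⊆ Λ`, every translation-invariant `ω` has `ω(Γ A − Γ(τ_v A)) = 0` on `𝔄_Λ` — the admissible
multipliers of `varPressure_gcInteractionTT'_le_log_partitionFn_boost_sub`. [cite: BratteliRobinsonI1987, §4.3.1] -/
theorem IsTranslationInvariant.expect_fermionEmbed_sub_fermionEmbed_shift {d : ℕ} {ω : InfVolFermionState d}
    (hω : ω.IsTranslationInvariant) {X Λ : Finset (Site d)} (hX : X ⊆ Λ) (v : Site d) (hv : shiftSet v X ⊆ Λ) (A : FermionOp X) :
    ω.expect Λ (fermionEmbed (PolySite.incl hX) A -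
      fermionEmbed (PolySite.incl hv) (fermionEmbed (PolySite.shiftEmb v X) A)) = 0 := by
  rw [map_sub, ω.compatible hX, ω.compatible hv, ← shift_expect, hω v, sub_self]

end InfVolFermionState

/-! ### §5 By name: `gcPressureTT'Zeeman` and the open-box matrix (`β ≥ 0`, `U ≥ 0`) -/

section ByName

variable {β : ℝ} (hβ : 0 ≤ β) (t t' : ℝ) {U : ℝ} (hU : 0 ≤ U) (μ hz : ℝ)
include hβ hU

/-- **THE T > 0 CLUSTER CAP, by name** (`β ≥ 0`, `U ≥ 0`, `ℓ ≥ 2`):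
`ℓ² · P(β; t,t',U; μ,h) ≤ log Re Ξ^open_ℓ(β; κt, κ²t', U; μ, h)`, `κ = ℓ/(ℓ−1)`, `Ξ^open_ℓ` the grand-canonical partition function of the
open `ℓ × ℓ` cluster `hubbardOpenBoxTT' ℓ ℓ (κt) (κ²t') U − μN − hM`. [cite: Israel1979, Lemma II.3.1] [cite: ArakiMoriya2003, Theorem 3.8 and §10]
[cite: ValentiStolzeHirschfeld1991, §II] -/
theorem sq_mul_gcPressureTT'Zeeman_le_log_partitionFn_openBox_boost {ℓ : ℕ} (hℓ : 2 ≤ ℓ) :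
    (ℓ : ℝ) ^ 2 * gcPressureTT'Zeeman β t t' U μ hz ≤
      Real.log (partitionFn β (hubbardOpenBoxTT' ℓ ℓ ((ℓ : ℝ) / ((ℓ : ℝ) - 1) * t) (((ℓ : ℝ) / ((ℓ : ℝ) - 1)) ^ 2 * t') U -
        (μ : ℂ) • totalNumber - (hz : ℂ) • spinImbalance)).re := by
  rw [← varPressure_gcInteractionTT'_eq hβ t t' hU μ hz, ← partitionFn_gcLocalHamiltonianTT'_halfOpenBox]
  have h := InfVolFermionState.varPressure_gcInteractionTT'_le_log_partitionFn_boost β t t' U μ hz hℓ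
  have hℓpos : (0 : ℝ) < ℓ := by exact_mod_cast (show 0 < ℓ by omega)
  rwa [le_div_iff₀ (by positivity), mul_comm] at h

/-- **THE TWO-SIDED CLUSTER WINDOW** (`β ≥ 0`, `U ≥ 0`, `ℓ ≥ 2`):
`log Re Ξ^open_ℓ(β; t, t', U; μ,h) ≤ ℓ² · P(β; t,t',U; μ,h) ≤ log Re Ξ^open_ℓ(β; κt, κ²t', U; μ,h)` — ONE open cluster, evaluated at the
physical and at the boosted hoppings, brackets the thermodynamic pressure. [cite: Ruelle1969, §3.4] [cite: Israel1979, Lemma II.3.1]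
[cite: ValentiStolzeHirschfeld1991, §II] -/
theorem sq_mul_gcPressureTT'Zeeman_mem_Icc_openBox {ℓ : ℕ} (hℓ : 2 ≤ ℓ) :
    (ℓ : ℝ) ^ 2 * gcPressureTT'Zeeman β t t' U μ hz ∈
      Set.Icc (Real.log (partitionFn β (hubbardOpenBoxTT' ℓ ℓ t t' U - (μ : ℂ) • totalNumber - (hz : ℂ) • spinImbalance)).re)
        (Real.log (partitionFn β (hubbardOpenBoxTT' ℓ ℓ ((ℓ : ℝ) / ((ℓ : ℝ) - 1) * t) (((ℓ : ℝ) / ((ℓ : ℝ) - 1)) ^ 2 * t') U -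
          (μ : ℂ) • totalNumber - (hz : ℂ) • spinImbalance)).re) :=
  ⟨log_partitionFn_openBox_gc_le_sq_mul_gcPressure hβ t t' hU μ hz (by omega),
    sq_mul_gcPressureTT'Zeeman_le_log_partitionFn_openBox_boost hβ t t' hU μ hz hℓ⟩

/-- **Certificate form**: certified numbers `z_lo ≤ log Re Ξ^open_ℓ(t,t')` and `log Re Ξ^open_ℓ(κt, κ²t') ≤ z_hi` (same `β, U, μ, h`; `ℓ ≥ 2`)
give the certified thermodynamic-limit window `z_lo/ℓ² ≤ P(β; t,t',U; μ,h) ≤ z_hi/ℓ²`. [cite: Ruelle1969, §3.4] [cite: Israel1979, Lemma II.3.1] -/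
theorem gcPressureTT'Zeeman_mem_Icc_of_openBox_certificates {ℓ : ℕ} (hℓ : 2 ≤ ℓ) {zlo zhi : ℝ}
    (hlo : zlo ≤ Real.log (partitionFn β (hubbardOpenBoxTT' ℓ ℓ t t' U - (μ : ℂ) • totalNumber - (hz : ℂ) • spinImbalance)).re)
    (hhi : Real.log (partitionFn β (hubbardOpenBoxTT' ℓ ℓ ((ℓ : ℝ) / ((ℓ : ℝ) - 1) * t) (((ℓ : ℝ) / ((ℓ : ℝ) - 1)) ^ 2 * t') U -
      (μ : ℂ) • totalNumber - (hz : ℂ) • spinImbalance)).re ≤ zhi) :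
    gcPressureTT'Zeeman β t t' U μ hz ∈ Set.Icc (zlo / (ℓ : ℝ) ^ 2) (zhi / (ℓ : ℝ) ^ 2) := by
  obtain ⟨h1, h2⟩ := sq_mul_gcPressureTT'Zeeman_mem_Icc_openBox hβ t t' hU μ hz hℓ
  have hℓpos : (0 : ℝ) < ℓ := by exact_mod_cast (show 0 < ℓ by omega)
  have hℓ2 : (0 : ℝ) < (ℓ : ℝ) ^ 2 := by positivity
  constructor
  · rw [div_le_iff₀ hℓ2, mul_comm]; exact hlo.trans h1
  · rw [le_div_iff₀ hℓ2, mul_comm]; exact h2.trans hhi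

/-- **THE PLAQUETTE CAP** (`ℓ = 2`, `κ = 2`): `4 · P(β; t,t',U; μ,h) ≤ log Re Ξ^open_{2×2}(β; 2t, 4t', U; μ, h)` — the `2 × 2` plaquette with
doubled nearest-neighbour and quadrupled diagonal hopping caps the thermodynamic pressure at every temperature (`β ≥ 0`, `U ≥ 0`).
[cite: Israel1979, Lemma II.3.1] [cite: ValentiStolzeHirschfeld1991, §II] -/
theorem four_mul_gcPressureTT'Zeeman_le_log_partitionFn_plaquette :
    4 * gcPressureTT'Zeeman β t t' U μ hz ≤
      Real.log (partitionFn β (hubbardOpenBoxTT' 2 2 (2 * t) (4 * t') U - (μ : ℂ) • totalNumber -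
        (hz : ℂ) • spinImbalance)).re := by
  have h := sq_mul_gcPressureTT'Zeeman_le_log_partitionFn_openBox_boost hβ t t' hU μ hz (le_refl 2)
  norm_num at h
  exact h

/-- **Canonical reading at fixed filling, any field** (`0 ≤ n < 2`, every `μ`): a certified cap `log Re Ξ^open_ℓ(κt, κ²t'; μ, h) ≤ z_hi` gives
`pressureTT'Zeeman β t t' U n h ≤ z_hi/ℓ² − βμn` (Legendre: `p(n,h) + βμn ≤ P(μ,h)`); optimise over `μ`. [cite: Ruelle1969, §3.4] -/
theorem pressureTT'Zeeman_le_of_openBox_certificate {ℓ : ℕ} (hℓ : 2 ≤ ℓ) {n : ℝ} (hn0 : 0 ≤ n) (hn2 : n < 2) {zhi : ℝ}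
    (hhi : Real.log (partitionFn β (hubbardOpenBoxTT' ℓ ℓ ((ℓ : ℝ) / ((ℓ : ℝ) - 1) * t) (((ℓ : ℝ) / ((ℓ : ℝ) - 1)) ^ 2 * t') U -
      (μ : ℂ) • totalNumber - (hz : ℂ) • spinImbalance)).re ≤ zhi) :
    pressureTT'Zeeman β t t' U n hz ≤ zhi / (ℓ : ℝ) ^ 2 - β * μ * n := by
  have h1 := pressureTT'Zeeman_add_le_gcPressureTT'Zeeman hβ t t' hU μ hz hn0 hn2
  have h2 := sq_mul_gcPressureTT'Zeeman_le_log_partitionFn_openBox_boost hβ t t' hU μ hz hℓ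
  have hℓpos : (0 : ℝ) < ℓ := by exact_mod_cast (show 0 < ℓ by omega)
  have hℓ2 : (0 : ℝ) < (ℓ : ℝ) ^ 2 := by positivity
  have h3 : gcPressureTT'Zeeman β t t' U μ hz ≤ zhi / (ℓ : ℝ) ^ 2 := by
    rw [le_div_iff₀ hℓ2, mul_comm]; exact h2.trans hhi
  linarith

/-- **Canonical reading at zero field** (`0 ≤ n < 2`, every `μ`): `pressureTT' β t t' U n ≤ z_hi/ℓ² − βμn` from a certified cap
`log Re Ξ^open_ℓ(κt, κ²t'; μ, 0) ≤ z_hi`. [cite: Ruelle1969, §3.4] -/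
theorem pressureTT'_le_of_openBox_certificate {ℓ : ℕ} (hℓ : 2 ≤ ℓ) {n : ℝ} (hn0 : 0 ≤ n) (hn2 : n < 2) {zhi : ℝ}
    (hhi : Real.log (partitionFn β (hubbardOpenBoxTT' ℓ ℓ ((ℓ : ℝ) / ((ℓ : ℝ) - 1) * t) (((ℓ : ℝ) / ((ℓ : ℝ) - 1)) ^ 2 * t') U -
      (μ : ℂ) • totalNumber - ((0 : ℝ) : ℂ) • spinImbalance)).re ≤ zhi) :
    pressureTT' β t t' U n ≤ zhi / (ℓ : ℝ) ^ 2 - β * μ * n := by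
  have h1 := pressureTT'_le_gcPressureTT'_sub hβ t t' hU μ hn0 hn2
  have h2 := sq_mul_gcPressureTT'Zeeman_le_log_partitionFn_openBox_boost hβ t t' hU μ 0 hℓ
  rw [gcPressureTT'Zeeman_zero] at h2
  have hℓpos : (0 : ℝ) < ℓ := by exact_mod_cast (show 0 < ℓ by omega)
  have hℓ2 : (0 : ℝ) < (ℓ : ℝ) ^ 2 := by positivity
  have h3 : gcPressureTT' β t t' U μ ≤ zhi / (ℓ : ℝ) ^ 2 := by
    rw [le_div_iff₀ hℓ2, mul_comm]; exact h2.trans hhi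
  linarith

end ByName

end Literature.MathematicalPhysics.QuantumLattice

end
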